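/-
Copyright (c) 2026 the pub-hodgecm-mathlib formalisation cell (harness21).  Prover seat hodgecm-mathlib-K2E1-p16 (g2), Track B ∕ K2-LIT, h413 = `stmt-HodgeConjecture-24833`,
R90-TF section S8 «ContSpec-n½» (dealer R90-CS-plan (g0), LEAD K2E1-plan (g7)), hand p08 «R6-orth» (ROAD `R90/S8/ROAD-S8B2.K2E1-p13-g3.md` row R6): the BLOCK-LEVEL
orthogonality of non-associate families of twisted pseudo-Eisenstein series on `U(1,1)_{L∕L⁺}`, from ★ (XF) `K2E1ChiPseudoEisensteinInnerProductCMTwo`.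
-/
import Summits.HodgeConjecture.HodgeConjecture.Theorems.K2E1ChiPseudoEisensteinInnerProductCMTwo   -- ★ (XF) `chiPseudoEisenstein_inner_product_eq_zero_cm_two` (K2E3-p12): generator-level vanishing for `C²` profiles
import Summits.HodgeConjecture.HodgeConjecture.Theorems.K2E1PseudoEisensteinSmoothBricksDenseU2     -- ★ (K2E1-p15) §1 `exists_band_forall_smooth_approx`, §2 `norm_toLp_sub_toLp_le_of_band` (ω-free); ★ `memLp_quotFun_eisensteinSeriesU_of_nice`, ★ `chiSectionSpace`
import HarnessLib

/-!
# `K2E1ChiPseudoEisensteinFamiliesOrthogonalCMTwo` — NON-ASSOCIATE FAMILIES OF TWISTED PSEUDO-EISENSTEIN SERIES SPAN ORTHOGONAL CLOSED BLOCKS OF `L²(𝔛)`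
# (`U(1,1)_{L∕L⁺}`; ROAD-S8B2 row R6 «orthogonality of families», block currency of ★ C7 HEAD″ p861008 :268, every `K`-type `ω`)

Track B ∕ K2-LIT, crux h413 = `stmt-HodgeConjecture-24833`, route of record `HCCMUnconditional`; cell `hodgecm-mathlib`, R90-TF section S8 (Rogawski 1990 §13.9, the residual
spectrum; H-side `U(Φ₂)`), hand p08.  THEOREMS ONLY (no `def`, no `instance`, no `notation`, no named-fact hypothesis, no `sorry`); lane `--supports stmt-HodgeConjecture-24833
--as helper` (count-neutral).

THE MATHEMATICS ([MoeglinWaldspurger1995, II.2.1: pseudo-Eisenstein series attached to non-associate cuspidal data are orthogonal]; here the cuspidal data of the Borel of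
`U(1,1)` are unitary Hecke characters `χ` of `L`, and «associate» means `χ′ ∈ {χ, χʷ}` up to a norm twist `‖·‖^s`, `χʷ = reflectChar c χ`).  ★ (XF)
`chiPseudoEisenstein_inner_product_eq_zero_cm_two` proves, by unfolding + Parseval on the idele class group, that for UNITARY `χ, χ′` with NEITHER `χχ′⁻¹` NOR `χ(χ′ʷ)⁻¹` a
norm twist the pairing `∫_𝔛 θ_{f,φ} · conj θ_{f′,φ′} dμ` VANISHES for all continuous bounded `χ`-∕`χ′`-sections `φ, φ′` and all profiles `f, f′ ∈ C²_c((0,∞))`.  The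
blocks of the C7 road (★ `K2E1PseudoEisensteinFamilyDecompositionOpenCosetsU2.orthogonal_inf_isotypic_le_topologicalClosure_biSup_family_open`, p861008 :268) are the CLOSED SPANS
`Blk_ω(χ) = closure span {[θ_{f,φ}] : f ∈ C_c((0,∞)) CONTINUOUS, φ ∈ chiSectionSpace χ K′ ω continuous}` — continuous profiles, any `K`-type `ω : K′ → ℂ`.  This file closes
the two gaps between the generator statement and the block statement:
* §1 **`topologicalClosure_span_continuous_eq_smooth_kType`** — the `ω`-TWISTED edition of ★ `K2E1PseudoEisensteinSmoothBricksDenseU2.topologicalClosure_span_continuous_eq_smooth`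
  (there `ω = 1`): continuous-profile and smooth-profile (`C^∞_c`) bricks of the `ω`-twisted family of `χ` have the SAME closed span (proof = ★ §3 verbatim with `1 ↦ ω`: the
  approximation ★ §1 `exists_band_forall_smooth_approx` and the `L²` estimate ★ §2 `norm_toLp_sub_toLp_le_of_band` are `ω`-free; letter `hχb` «continuous `χ`-sections of level
  `(K′, ω)` are bounded», as there).  [MoeglinWaldspurger1995 II.1.2–II.1.3; Folland Prop. 8.17.]
* §2 **`inner_toLp_chiPseudoEisenstein_eq_zero_of_not_isNormTwist`** — `L²` glue: `⟪[θ_{f,φ}], [θ_{f′,φ′}]⟫_{L²(𝔛,μ)} = 0` for `C²` profiles, from (XF) (`⟪[θ],[θ′]⟫ = ∫ conj θ · θ′ =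
  conj ∫ θ · conj θ′`, Mathlib `L2.inner_def`, `integral_conj`).
* §3 **`isOrtho_topologicalClosure_of_isOrtho`** (generic Hilbert-space bookkeeping: `U ⟂ V ⇒ Ū ⟂ V̄`, Mathlib `Submodule.orthogonal_closure`) and the HEAD
  **`isOrtho_topologicalClosure_span_family_of_not_isNormTwist`** — `Blk_ω(χ) ⟂ Blk_ω(χ′)` in `L²(𝔛, μ)` for unitary `χ, χ′` with `¬(χχ′⁻¹).IsNormTwist`, `¬(χ(χ′ʷ)⁻¹).IsNormTwist`,
  the p861008 :268 generator sets VERBATIM (element type `𝒢.L2 μ`), under (XF)'s Haar∕fundamental-domain binders `νG μK νI 𝓕I ν 𝓕` and the two `hχb`-letters: §1 moves both blocks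
  to smooth profiles, Mathlib `Submodule.isOrtho_span` + §2 makes the smooth spans orthogonal, §3 passes to closures.  For RAY-TRIVIAL `χ ≠ χ′, χ′ ≠ χʷ` the two «not a norm
  twist» hypotheses are ★ `K2E1FamilyIndexSplitSelfDualU2.not_isNormTwist_mul_inv_reflectChar_of_rayTrivial_of_ne`-type facts (consumer's side).
CONSUMER: the S8B#4∕#2 assembly (ROAD-S8B2 §2 «ASSEMBLY shape»: an irreducible `P ≤ L²_res` meets ONE block) and E1's `hEXH`∕`hatoms` road (ROADCARD «5Res BY FAMILIES»), which
until now carried orthogonality-FREE exhaustion only (★ p860760 `exhaustion_injective_of_blocks`).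
HONEST LABEL: HC_CM is proved only modulo the 7 printed citations (2 remaining named inputs: hLiu418 = `stmt-HodgeConjecture-24832`, h413 = `stmt-HodgeConjecture-24833`) until rung 0
closes; this file asserts no named fact and closes no socket; count-neutral; letters: (XF)'s structural Haar data and the two `hχb` bounds, visible.

## References
* [MoeglinWaldspurger1995] C. Mœglin, J.-L. Waldspurger, *Spectral decomposition and Eisenstein series* (1995), II.1.2–II.1.3, II.2.1.
* [TateThesis1967] J. Tate, *Fourier analysis in number fields and Hecke's zeta-functions*, in Cassels–Fröhlich (1967), Thm. 4.4.1.
* [Folland1999] G. B. Folland, *Real Analysis*, 2nd ed. (1999), Prop. 8.17.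
* [Rogawski1990] J. D. Rogawski, *Automorphic Representations of Unitary Groups in Three Variables* (1990), §13.9 p. 229.
-/

set_option autoImplicit false
set_option linter.dupNamespace false  -- the mandated namespace repeats the summit's segment (`HodgeConjecture.HodgeConjecture`)

noncomputable section

open MeasureTheory Measure Set Filter Topology NumberField IsDedekindDomain Metric
open scoped NNReal ENNReal ComplexConjugate InnerProductSpace
open Literature.NumberTheory.Automorphic Literature.NumberTheory.Automorphic.UnitaryGroup AdelicGroupData
open Literature.NumberTheory.GaloisRepresentations (HeckeCharacter)
open Summit.HodgeConjecture.HodgeConjecture.Cruxes.H413.K2E1BorelEisensteinU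
open Summit.HodgeConjecture.HodgeConjecture.Cruxes.H413.K2E1CharacterEisensteinU2Defs
open Summit.HodgeConjecture.HodgeConjecture.Cruxes.H413.K2E1ChiSectionSpaceU2Defs
open Summit.HodgeConjecture.HodgeConjecture.Cruxes.H413.K2E1EisensteinSupNormBandBoundCMTwo (exists_const_norm_eisensteinSeriesU_le_cm eisensteinSeriesU_eq_finset_sum_of_band norm_toLp_quotFun_le_of_forall_norm_le)
open Summit.HodgeConjecture.HodgeConjecture.Cruxes.H413.K2E1EisensteinNiceClassCMTwo (memLp_quotFun_eisensteinSeriesU_of_nice)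
open Summit.HodgeConjecture.HodgeConjecture.Cruxes.H413.K2E1PseudoEisensteinSmoothBricksDenseU2 (exists_band_forall_smooth_approx norm_toLp_sub_toLp_le_of_band)
open Summit.HodgeConjecture.HodgeConjecture.Cruxes.H413.K2E1ChiPseudoEisensteinInnerProductCMTwo (chiPseudoEisenstein_inner_product_eq_zero_cm_two)

namespace Summit.HodgeConjecture.HodgeConjecture.Cruxes.H413.K2E1ChiPseudoEisensteinFamiliesOrthogonalCMTwo

/-! ## §0 Generic: orthogonality passes to closures -/

/-- **`U ⟂ V ⇒ Ū ⟂ V̄`** in any inner product space: `U ≤ Vᗮ = V̄ᗮ` (Mathlib `Submodule.orthogonal_closure`) and `V̄ᗮ` is closed. [folklore] -/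
theorem isOrtho_topologicalClosure_of_isOrtho {𝕜 E : Type*} [RCLike 𝕜] [NormedAddCommGroup E] [InnerProductSpace 𝕜 E] {U V : Submodule 𝕜 E}
    (h : U ⟂ V) : U.topologicalClosure ⟂ V.topologicalClosure := by
  rw [Submodule.isOrtho_iff_le] at h ⊢
  rw [Submodule.orthogonal_closure]
  exact U.topologicalClosure_minimal h (Submodule.isClosed_orthogonal _)

section CM

variable (L : Type) [Field L] [NumberField L] [IsCMField L]
  [MeasurableSpace (quasiSplit (↥(maximalRealSubfield L)) L (IsCMField.complexConj L) 2).Adelic] [BorelSpace (quasiSplit (↥(maximalRealSubfield L)) L (IsCMField.complexConj L) 2).Adelic]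

/-! ## §1 The `ω`-twisted bricks with continuous and with smooth profiles have the same closed span (★ `…SmoothBricksDenseU2` §3 with `1 ↦ ω`) -/

/-- **THE `ω`-TWISTED BRICKS WITH CONTINUOUS PROFILES AND WITH SMOOTH PROFILES HAVE THE SAME CLOSED SPAN IN `L²(𝔛)`** — for every Hecke character `χ`, every level subgroup `K′`, every
`K`-type `ω : K′ → ℂ` and every finite measure `μ` on `𝔛`, provided the continuous `χ`-sections of level `(K′, ω)` are bounded (letter `hχb`).  The `ω = 1` case is ★
`K2E1PseudoEisensteinSmoothBricksDenseU2.topologicalClosure_span_continuous_eq_smooth`; the proof is that proof verbatim (`⊇` trivial; `⊆`: a continuous-profile brick `[θ_{f,φ}]` is the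
`L²`-limit of the smooth-profile bricks `[θ_{g_n,φ}]` of ★ §1, common band, by the `ω`-free estimate ★ §2). [cite: MoeglinWaldspurger1995, II.1.2–II.1.3] [cite: Folland1999, Prop. 8.17] -/
theorem topologicalClosure_span_continuous_eq_smooth_kType (μ : Measure (quasiSplit (↥(maximalRealSubfield L)) L (IsCMField.complexConj L) 2).automorphicQuotient) [IsFiniteMeasure μ]
    (χ : HeckeCharacter L) (K' : Subgroup (quasiSplit (↥(maximalRealSubfield L)) L (IsCMField.complexConj L) 2).Adelic) (ω : ↥K' → ℂ)
    (hχb : ∀ φ : (quasiSplit (↥(maximalRealSubfield L)) L (IsCMField.complexConj L) 2).Adelic → ℂ, φ ∈ chiSectionSpace χ K' ω → Continuous φ → ∃ M : ℝ, ∀ g, ‖φ g‖ ≤ M) :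
    (Submodule.span ℂ {v : Lp ℂ 2 μ |
      ∃ (f : ℝ → ℂ) (_ : Continuous f) (_ : HasCompactSupport f) (_ : tsupport f ⊆ Ioi 0)
        (φ : (quasiSplit (↥(maximalRealSubfield L)) L (IsCMField.complexConj L) 2).Adelic → ℂ) (_ : φ ∈ chiSectionSpace χ K' ω) (_ : Continuous φ)
        (hv : MemLp ((quasiSplit (↥(maximalRealSubfield L)) L (IsCMField.complexConj L) 2).quotFun (eisensteinSeriesU (fun g => f (borelHeight g) * φ g))) 2 μ), v = hv.toLp _}).topologicalClosure =
    (Submodule.span ℂ {v : Lp ℂ 2 μ |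
      ∃ (f : ℝ → ℂ) (_ : ContDiff ℝ (⊤ : ℕ∞) f) (_ : Continuous f) (_ : HasCompactSupport f) (_ : tsupport f ⊆ Ioi 0)
        (φ : (quasiSplit (↥(maximalRealSubfield L)) L (IsCMField.complexConj L) 2).Adelic → ℂ) (_ : φ ∈ chiSectionSpace χ K' ω) (_ : Continuous φ)
        (hv : MemLp ((quasiSplit (↥(maximalRealSubfield L)) L (IsCMField.complexConj L) 2).quotFun (eisensteinSeriesU (fun g => f (borelHeight g) * φ g))) 2 μ), v = hv.toLp _}).topologicalClosure := by
  classical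
  apply le_antisymm
  · -- `⊆`: every continuous-profile brick is a limit of smooth-profile bricks
    refine (Submodule.topologicalClosure_minimal _ ?_ (Submodule.isClosed_topologicalClosure _))
    refine Submodule.span_le.2 ?_
    rintro v ⟨f, hf, hfs, hf0, φ, hφV, hφc, hv, rfl⟩
    obtain ⟨Mφ, hMφ⟩ := hχb φ hφV hφc
    have hφB : ∀ b ∈ arithmeticBorel (↥(maximalRealSubfield L)) L (IsCMField.complexConj L) 2, ∀ x, φ ((b : (quasiSplit (↥(maximalRealSubfield L)) L (IsCMField.complexConj L) 2).Adelic) * x) = φ x :=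
      hφV.1.arithmeticBorel_mul
    -- the band of `f` and the smooth approximants at precision `1∕(n+1)`
    obtain ⟨a, b, ha, hfa, happ⟩ := exists_band_forall_smooth_approx hf hfs hf0
    choose g hg hgs hg0 hga hgε using fun n : ℕ => happ (1 / ((n : ℝ) + 1)) (by positivity)
    obtain ⟨Mf, hMf⟩ := hf.bounded_above_of_compact_support hfs
    -- the profiles on the group
    set u : (quasiSplit (↥(maximalRealSubfield L)) L (IsCMField.complexConj L) 2).Adelic → ℂ := fun x => f (borelHeight x) * φ x with hu
    set w : ℕ → (quasiSplit (↥(maximalRealSubfield L)) L (IsCMField.complexConj L) 2).Adelic → ℂ := fun n x => g n (borelHeight x) * φ x with hw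
    have hH : ∀ β' ∈ arithmeticBorel (↥(maximalRealSubfield L)) L (IsCMField.complexConj L) 2, ∀ x : (quasiSplit (↥(maximalRealSubfield L)) L (IsCMField.complexConj L) 2).Adelic,
        borelHeight ((β' : (quasiSplit (↥(maximalRealSubfield L)) L (IsCMField.complexConj L) 2).Adelic) * x) = borelHeight x := fun β' hβ' x => K2E1TruncatedEisensteinExplicit.borelHeight_arithmeticBorel_mul hβ' x
    have huB : ∀ β' ∈ arithmeticBorel (↥(maximalRealSubfield L)) L (IsCMField.complexConj L) 2, ∀ x, u ((β' : (quasiSplit (↥(maximalRealSubfield L)) L (IsCMField.complexConj L) 2).Adelic) * x) = u x := fun β' hβ' x => by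
      simp only [hu, hH β' hβ' x, hφB β' hβ' x]
    have hwB : ∀ n, ∀ β' ∈ arithmeticBorel (↥(maximalRealSubfield L)) L (IsCMField.complexConj L) 2, ∀ x, w n ((β' : (quasiSplit (↥(maximalRealSubfield L)) L (IsCMField.complexConj L) 2).Adelic) * x) = w n x := fun n β' hβ' x => by
      simp only [hw, hH β' hβ' x, hφB β' hβ' x]
    -- the common height cut-off `a₀ = a∕2`
    set a₀ : ℝ≥0 := (a / 2).toNNReal with ha₀
    have ha₀c : ((a₀ : ℝ≥0) : ℝ) = a / 2 := by rw [ha₀]; exact Real.coe_toNNReal _ (by positivity)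
    have ha₀0 : 0 < a₀ := by rw [← NNReal.coe_pos, ha₀c]; positivity
    set b₀ : ℝ≥0 := (max b 0).toNNReal with hb₀
    have hb₀c : ((b₀ : ℝ≥0) : ℝ) = max b 0 := by rw [hb₀]; exact Real.coe_toNNReal _ (le_max_right _ _)
    have hbelow : ∀ (p : ℝ → ℂ), (∀ y, p y ≠ 0 → a ≤ y ∧ y ≤ b) → ∀ x : (quasiSplit (↥(maximalRealSubfield L)) L (IsCMField.complexConj L) 2).Adelic, borelHeight x ≤ a₀ → p (borelHeight x) * φ x = 0 := by
      intro p hp x hx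
      by_cases h0 : p (borelHeight x) = 0
      · rw [h0, zero_mul]
      · exfalso
        have h1 := (hp _ h0).1
        have h2 : ((borelHeight x : ℝ≥0) : ℝ) ≤ a / 2 := by rw [← ha₀c]; exact_mod_cast hx
        linarith
    have hua : ∀ x : (quasiSplit (↥(maximalRealSubfield L)) L (IsCMField.complexConj L) 2).Adelic, borelHeight x ≤ a₀ → u x = 0 := hbelow f hfa
    have hwa : ∀ n, ∀ x : (quasiSplit (↥(maximalRealSubfield L)) L (IsCMField.complexConj L) 2).Adelic, borelHeight x ≤ a₀ → w n x = 0 := fun n => hbelow (g n) (hga n)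
    -- the classes of the approximants are smooth-profile bricks
    have hband : ∀ n, ∀ x : (quasiSplit (↥(maximalRealSubfield L)) L (IsCMField.complexConj L) 2).Adelic, w n x ≠ 0 → a₀ ≤ borelHeight x ∧ borelHeight x ≤ b₀ := by
      intro n x hx
      have hg' : g n (borelHeight x) ≠ 0 := fun h => hx (by simp only [hw, h, zero_mul])
      obtain ⟨h1, h2⟩ := hga n _ hg'
      refine ⟨?_, ?_⟩
      · rw [← NNReal.coe_le_coe, ha₀c]; linarith
      · rw [← NNReal.coe_le_coe, hb₀c]; exact h2.trans (le_max_left _ _)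
    have hwM : ∀ n x, ‖w n x‖ ≤ (Mf + 1) * Mφ := by
      intro n x
      rw [hw]; simp only [norm_mul]
      refine mul_le_mul ?_ (hMφ x) (norm_nonneg _) (by linarith [(norm_nonneg _).trans (hMf 1)])
      calc ‖g n (borelHeight x)‖ = ‖(g n (borelHeight x) - f (borelHeight x)) + f (borelHeight x)‖ := by rw [sub_add_cancel]
        _ ≤ ‖g n (borelHeight x) - f (borelHeight x)‖ + ‖f (borelHeight x)‖ := norm_add_le _ _
        _ ≤ 1 / ((n : ℝ) + 1) + Mf := add_le_add (hgε n _) (hMf _)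
        _ ≤ 1 + Mf := by
            refine add_le_add ?_ le_rfl
            rw [div_le_one (by positivity)]; linarith [n.cast_nonneg (α := ℝ)]
        _ = Mf + 1 := add_comm _ _
    have hwc : ∀ n, Continuous (w n) := fun n => ((hg n).continuous.comp (NNReal.continuous_coe.comp continuous_borelHeight)).mul hφc
    have hvw : ∀ n, MemLp ((quasiSplit (↥(maximalRealSubfield L)) L (IsCMField.complexConj L) 2).quotFun (eisensteinSeriesU (w n))) 2 μ := fun n =>
      memLp_quotFun_eisensteinSeriesU_of_nice L μ 2 (hwc n) (hwB n) (hwM n) ha₀0 (hband n)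
    have hmem : ∀ n, (hvw n).toLp _ ∈ Submodule.span ℂ {v : Lp ℂ 2 μ |
        ∃ (f : ℝ → ℂ) (_ : ContDiff ℝ (⊤ : ℕ∞) f) (_ : Continuous f) (_ : HasCompactSupport f) (_ : tsupport f ⊆ Ioi 0)
          (φ : (quasiSplit (↥(maximalRealSubfield L)) L (IsCMField.complexConj L) 2).Adelic → ℂ) (_ : φ ∈ chiSectionSpace χ K' ω) (_ : Continuous φ)
          (hv : MemLp ((quasiSplit (↥(maximalRealSubfield L)) L (IsCMField.complexConj L) 2).quotFun (eisensteinSeriesU (fun g => f (borelHeight g) * φ g))) 2 μ), v = hv.toLp _} :=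
      fun n => Submodule.subset_span ⟨g n, hg n, (hg n).continuous, hgs n, hg0 n, φ, hφV, hφc, hvw n, rfl⟩
    -- the `L²` estimate and the limit
    obtain ⟨C, hC0, hC⟩ := norm_toLp_sub_toLp_le_of_band L μ ha₀0
    have hdist : ∀ n, ‖hv.toLp _ - (hvw n).toLp _‖ ≤ (measureUnivNNReal μ : ℝ) ^ (2 : ℝ)⁻¹ * (C * (Mφ * (1 / ((n : ℝ) + 1)))) := by
      intro n
      refine hC u (w n) huB (hwB n) hua (hwa n) _ (fun x => ?_) hv (hvw n)
      rw [hu, hw]; simp only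
      rw [← sub_mul, norm_mul, mul_comm]
      exact mul_le_mul (hMφ x) (by rw [norm_sub_rev]; exact hgε n _) (norm_nonneg _) ((norm_nonneg _).trans (hMφ x))
    have hlim : Tendsto (fun n => (hvw n).toLp _) atTop (𝓝 (hv.toLp _)) := by
      rw [tendsto_iff_norm_sub_tendsto_zero]
      have h0 : Tendsto (fun n : ℕ => (measureUnivNNReal μ : ℝ) ^ (2 : ℝ)⁻¹ * (C * (Mφ * (1 / ((n : ℝ) + 1))))) atTop (𝓝 0) := by
        have := ((tendsto_one_div_add_atTop_nhds_zero_nat.const_mul Mφ).const_mul C).const_mul ((measureUnivNNReal μ : ℝ) ^ (2 : ℝ)⁻¹)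
        simpa using this
      refine squeeze_zero (fun n => norm_nonneg _) (fun n => ?_) h0
      rw [norm_sub_rev]; exact hdist n
    rw [Submodule.topologicalClosure_coe]
    exact mem_closure_of_tendsto hlim (Eventually.of_forall hmem)
  · -- `⊇`: smooth profiles are continuous profiles
    refine Submodule.topologicalClosure_mono (Submodule.span_mono ?_)
    rintro v ⟨f, -, hf, hfs, hf0, φ, hφV, hφc, hv, rfl⟩
    exact ⟨f, hf, hfs, hf0, φ, hφV, hφc, hv, rfl⟩

/-! ## §2 `L²` glue: the bricks of non-associate families are orthogonal vectors (★ (XF) read through `L2.inner_def`) -/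

variable [MeasurableSpace (AdeleRing (𝓞 L) L)ˣ] [BorelSpace (AdeleRing (𝓞 L) L)ˣ]

/-- **`⟪[θ_{f,φ}], [θ_{f′,φ′}]⟫_{L²(𝔛,μ)} = 0` FOR NON-ASSOCIATE `χ, χ′`** (unitary; neither `χχ′⁻¹` nor `χ(χ′ʷ)⁻¹` a norm twist), continuous bounded `χ`-∕`χ′`-sections `φ, φ′`,
profiles `f, f′ ∈ C²_c((0,∞))`, and ANY square-integrability witnesses `hv, hv′` of the two pseudo-Eisenstein series: ★ (XF) `chiPseudoEisenstein_inner_product_eq_zero_cm_two` gives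
`∫ θ·conj θ′ = 0`, and `⟪[θ],[θ′]⟫ = ∫ conj θ·θ′ = conj ∫ θ·conj θ′` (Mathlib `L2.inner_def`, `MemLp.coeFn_toLp`, `integral_conj`).  Binders `νG μK νI 𝓕I ν 𝓕` = (XF)'s structural
Haar ∕ fundamental-domain data. [cite: MoeglinWaldspurger1995, II.2.1] [cite: TateThesis1967, Thm. 4.4.1] -/
theorem inner_toLp_chiPseudoEisenstein_eq_zero_of_not_isNormTwist
    (μ : Measure (quasiSplit (↥(maximalRealSubfield L)) L (IsCMField.complexConj L) 2).automorphicQuotient) [(quasiSplit (↥(maximalRealSubfield L)) L (IsCMField.complexConj L) 2).IsAutomorphicMeasure μ]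
    (νG : Measure (quasiSplit (↥(maximalRealSubfield L)) L (IsCMField.complexConj L) 2).Adelic) [νG.IsHaarMeasure] [νG.IsInvInvariant]
    (μK : Measure ((standardMaximalCompactGL 2 L).comap (adelicVal (↥(maximalRealSubfield L)) L (IsCMField.complexConj L) 2 ((StdForm.antidiagonal 2).over L)) : Subgroup (quasiSplit (↥(maximalRealSubfield L)) L (IsCMField.complexConj L) 2).Adelic)) [μK.IsHaarMeasure]
    (νI : Measure (AdeleRing (𝓞 L) L)ˣ) [νI.IsHaarMeasure]
    {𝓕I : Set (AdeleRing (𝓞 L) L)ˣ} (h𝓕I : IsIdeleClassDomain L 𝓕I)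
    (ν : Measure ↥(adelicUnipotent (↥(maximalRealSubfield L)) L (IsCMField.complexConj L) 2)) [ν.IsHaarMeasure] {𝓕 : Set ↥(adelicUnipotent (↥(maximalRealSubfield L)) L (IsCMField.complexConj L) 2)}
    (h𝓕N : IsFundamentalDomain ↥(rationalUnipotent (↥(maximalRealSubfield L)) L (IsCMField.complexConj L) 2) 𝓕 ν) (h𝓕c : IsCompact (closure 𝓕)) (h𝓕₀ : ν 𝓕 ≠ 0)
    {χ χ' : HeckeCharacter L} {φ φ' : (quasiSplit (↥(maximalRealSubfield L)) L (IsCMField.complexConj L) 2).Adelic → ℂ} (hχu : χ.IsUnitary) (hχ'u : χ'.IsUnitary)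
    (h₁ : ¬ (χ * χ'⁻¹).IsNormTwist) (h₂ : ¬ (χ * (reflectChar (IsCMField.complexConj L) χ')⁻¹).IsNormTwist)
    (hφ : IsChiSection χ φ) (hφc : Continuous φ) {Cφ : ℝ} (hφC : ∀ x, ‖φ x‖ ≤ Cφ)
    (hφ' : IsChiSection χ' φ') (hφ'c : Continuous φ') {Cφ' : ℝ} (hφ'C : ∀ x, ‖φ' x‖ ≤ Cφ')
    {f f' : ℝ → ℂ} (hf : ContDiff ℝ 2 f) (hfs : HasCompactSupport f) (hf0 : tsupport f ⊆ Ioi 0) (hf' : ContDiff ℝ 2 f') (hf's : HasCompactSupport f') (hf'0 : tsupport f' ⊆ Ioi 0)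
    (hv : MemLp ((quasiSplit (↥(maximalRealSubfield L)) L (IsCMField.complexConj L) 2).quotFun (eisensteinSeriesU (fun g : (quasiSplit (↥(maximalRealSubfield L)) L (IsCMField.complexConj L) 2).Adelic => f (borelHeight g : ℝ) * φ g))) 2 μ)
    (hv' : MemLp ((quasiSplit (↥(maximalRealSubfield L)) L (IsCMField.complexConj L) 2).quotFun (eisensteinSeriesU (fun g : (quasiSplit (↥(maximalRealSubfield L)) L (IsCMField.complexConj L) 2).Adelic => f' (borelHeight g : ℝ) * φ' g))) 2 μ) :
    ⟪(hv.toLp _ : (quasiSplit (↥(maximalRealSubfield L)) L (IsCMField.complexConj L) 2).L2 μ), hv'.toLp _⟫_ℂ = 0 := by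
  obtain ⟨-, h0⟩ := chiPseudoEisenstein_inner_product_eq_zero_cm_two L μ νG μK νI h𝓕I ν h𝓕N h𝓕c h𝓕₀ hχu hχ'u h₁ h₂ hφ hφc hφC hφ' hφ'c hφ'C hf hfs hf0 hf' hf's hf'0
  rw [L2.inner_def]
  have hae : (fun x => ⟪(hv.toLp _ : (quasiSplit (↥(maximalRealSubfield L)) L (IsCMField.complexConj L) 2).L2 μ) x, (hv'.toLp _ : (quasiSplit (↥(maximalRealSubfield L)) L (IsCMField.complexConj L) 2).L2 μ) x⟫_ℂ) =ᵐ[μ]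
      fun x => conj ((quasiSplit (↥(maximalRealSubfield L)) L (IsCMField.complexConj L) 2).quotFun (eisensteinSeriesU (fun g : (quasiSplit (↥(maximalRealSubfield L)) L (IsCMField.complexConj L) 2).Adelic => f (borelHeight g : ℝ) * φ g)) x *
        conj ((quasiSplit (↥(maximalRealSubfield L)) L (IsCMField.complexConj L) 2).quotFun (eisensteinSeriesU (fun g : (quasiSplit (↥(maximalRealSubfield L)) L (IsCMField.complexConj L) 2).Adelic => f' (borelHeight g : ℝ) * φ' g)) x)) := by
    filter_upwards [hv.coeFn_toLp, hv'.coeFn_toLp] with x hx hy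
    rw [hx, hy, map_mul, RCLike.conj_conj, RCLike.inner_apply, mul_comm]
  rw [integral_congr_ae hae, integral_conj, h0, map_zero]

/-! ## §3 HEAD: the closed blocks of non-associate families are orthogonal -/

/-- **ROAD-S8B2 ROW R6 «ORTHOGONALITY OF FAMILIES», BLOCK CURRENCY OF ★ C7 HEAD″ (p861008 :268), EVERY `K`-TYPE `ω`.**  For UNITARY Hecke characters `χ, χ′` of `L` such that NEITHER
`χ·χ′⁻¹` NOR `χ·(χ′ʷ)⁻¹` is a norm twist (`χ′` associate to neither `χ` nor `χʷ`), a level subgroup `K′ ≤ U(1,1)(𝔸_{L⁺})`, a `K`-type `ω : K′ → ℂ` whose continuous `χ`- and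
`χ′`-sections are bounded (letters `hχb`, `hχ'b`), and (XF)'s structural Haar ∕ fundamental-domain data: the CLOSED SPANS in `L²(𝔛, μ)` of the two families
`{[θ_{f,φ}] : f ∈ C_c((0,∞)) continuous, φ ∈ chiSectionSpace χ K′ ω continuous}` and `{[θ_{f′,φ′}] : … χ′ …}` (generator sets = ★ p861008 :268 VERBATIM) are ORTHOGONAL:
**`closure span(family χ) ⟂ closure span(family χ′)`**.  Proof: §1 (both closures = the smooth-profile closures) ∘ §0 ∘ Mathlib `Submodule.isOrtho_span` ∘ §2 (smooth ⊂ `C²`).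
[cite: MoeglinWaldspurger1995, II.2.1] [cite: TateThesis1967, Thm. 4.4.1] [cite: Rogawski1990, §13.9 p. 229] -/
theorem isOrtho_topologicalClosure_span_family_of_not_isNormTwist
    (μ : Measure (quasiSplit (↥(maximalRealSubfield L)) L (IsCMField.complexConj L) 2).automorphicQuotient) [(quasiSplit (↥(maximalRealSubfield L)) L (IsCMField.complexConj L) 2).IsAutomorphicMeasure μ]
    (νG : Measure (quasiSplit (↥(maximalRealSubfield L)) L (IsCMField.complexConj L) 2).Adelic) [νG.IsHaarMeasure] [νG.IsInvInvariant]
    (μK : Measure ((standardMaximalCompactGL 2 L).comap (adelicVal (↥(maximalRealSubfield L)) L (IsCMField.complexConj L) 2 ((StdForm.antidiagonal 2).over L)) : Subgroup (quasiSplit (↥(maximalRealSubfield L)) L (IsCMField.complexConj L) 2).Adelic)) [μK.IsHaarMeasure]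
    (νI : Measure (AdeleRing (𝓞 L) L)ˣ) [νI.IsHaarMeasure]
    {𝓕I : Set (AdeleRing (𝓞 L) L)ˣ} (h𝓕I : IsIdeleClassDomain L 𝓕I)
    (ν : Measure ↥(adelicUnipotent (↥(maximalRealSubfield L)) L (IsCMField.complexConj L) 2)) [ν.IsHaarMeasure] {𝓕 : Set ↥(adelicUnipotent (↥(maximalRealSubfield L)) L (IsCMField.complexConj L) 2)}
    (h𝓕N : IsFundamentalDomain ↥(rationalUnipotent (↥(maximalRealSubfield L)) L (IsCMField.complexConj L) 2) 𝓕 ν) (h𝓕c : IsCompact (closure 𝓕)) (h𝓕₀ : ν 𝓕 ≠ 0)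
    (K' : Subgroup (quasiSplit (↥(maximalRealSubfield L)) L (IsCMField.complexConj L) 2).Adelic) (ω : ↥K' → ℂ)
    {χ χ' : HeckeCharacter L} (hχu : χ.IsUnitary) (hχ'u : χ'.IsUnitary)
    (h₁ : ¬ (χ * χ'⁻¹).IsNormTwist) (h₂ : ¬ (χ * (reflectChar (IsCMField.complexConj L) χ')⁻¹).IsNormTwist)
    (hχb : ∀ φ : (quasiSplit (↥(maximalRealSubfield L)) L (IsCMField.complexConj L) 2).Adelic → ℂ, φ ∈ chiSectionSpace χ K' ω → Continuous φ → ∃ M : ℝ, ∀ g, ‖φ g‖ ≤ M)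
    (hχ'b : ∀ φ : (quasiSplit (↥(maximalRealSubfield L)) L (IsCMField.complexConj L) 2).Adelic → ℂ, φ ∈ chiSectionSpace χ' K' ω → Continuous φ → ∃ M : ℝ, ∀ g, ‖φ g‖ ≤ M) :
    (Submodule.span ℂ {v : (quasiSplit (↥(maximalRealSubfield L)) L (IsCMField.complexConj L) 2).L2 μ |
        ∃ (f : ℝ → ℂ) (_ : Continuous f) (_ : HasCompactSupport f) (_ : tsupport f ⊆ Ioi 0)
          (φ : (quasiSplit (↥(maximalRealSubfield L)) L (IsCMField.complexConj L) 2).Adelic → ℂ) (_ : φ ∈ chiSectionSpace χ K' ω) (_ : Continuous φ)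
          (hv : MemLp ((quasiSplit (↥(maximalRealSubfield L)) L (IsCMField.complexConj L) 2).quotFun (eisensteinSeriesU (fun g => f (borelHeight g) * φ g))) 2 μ), v = hv.toLp _}).topologicalClosure ⟂
    (Submodule.span ℂ {v : (quasiSplit (↥(maximalRealSubfield L)) L (IsCMField.complexConj L) 2).L2 μ |
        ∃ (f : ℝ → ℂ) (_ : Continuous f) (_ : HasCompactSupport f) (_ : tsupport f ⊆ Ioi 0)
          (φ : (quasiSplit (↥(maximalRealSubfield L)) L (IsCMField.complexConj L) 2).Adelic → ℂ) (_ : φ ∈ chiSectionSpace χ' K' ω) (_ : Continuous φ)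
          (hv : MemLp ((quasiSplit (↥(maximalRealSubfield L)) L (IsCMField.complexConj L) 2).quotFun (eisensteinSeriesU (fun g => f (borelHeight g) * φ g))) 2 μ), v = hv.toLp _}).topologicalClosure := by
  -- §1: both closures are the closures of the SMOOTH-profile spans
  rw [topologicalClosure_span_continuous_eq_smooth_kType L μ χ K' ω hχb, topologicalClosure_span_continuous_eq_smooth_kType L μ χ' K' ω hχ'b]
  -- §0: it suffices that the smooth-profile spans are orthogonal, i.e. (Mathlib) that their generators are
  refine isOrtho_topologicalClosure_of_isOrtho (Submodule.isOrtho_span.2 ?_)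
  rintro v ⟨f, hf, -, hfs, hf0, φ, hφV, hφc, hv, rfl⟩ v' ⟨f', hf', -, hf's, hf'0, φ', hφ'V, hφ'c, hv', rfl⟩
  obtain ⟨Cφ, hφC⟩ := hχb φ hφV hφc
  obtain ⟨Cφ', hφ'C⟩ := hχ'b φ' hφ'V hφ'c
  -- §2: smooth profiles are `C²`
  exact inner_toLp_chiPseudoEisenstein_eq_zero_of_not_isNormTwist L μ νG μK νI h𝓕I ν h𝓕N h𝓕c h𝓕₀ hχu hχ'u h₁ h₂ hφV.1 hφc hφC hφ'V.1 hφ'c hφ'C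
    (hf.of_le (WithTop.coe_le_coe.2 le_top)) hfs hf0 (hf'.of_le (WithTop.coe_le_coe.2 le_top)) hf's hf'0 hv hv'

end CM

end Summit.HodgeConjecture.HodgeConjecture.Cruxes.H413.K2E1ChiPseudoEisensteinFamiliesOrthogonalCMTwo

end
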